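import Literature.Computability.MetaComplexity.BoundedArithUnivStrict
import HarnessLib

/-!
# `Σᵇₖ₊₂`-PIND in Herbrand-saturated models of the universal theory; `S₂ᵏ⁺²`

Topic `Literature/Computability/MetaComplexity` (continuation of `BoundedArithUnivStrict.lean`).
We prove that every Herbrand-saturated model `K` of `QSym.univTheory k` satisfies polynomial
induction for `Σᵇₖ₊₂` formulas (`QSym.pind_of_isSigmab`), hence is a model of Buss's `S₂ᵏ⁺²`
on its reduct (`QSym.model_S2_of_isHerbrandSaturated`) — the field `model_S2_succ` of
`HerbrandRouteData (k + 1)` and the heart of the model-theoretic proof of Buss's conservation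
theorem (Buss 1990, Thm. 5; Avigad 2002, §4, where the case of `S₂¹` over `PV` is sketched):

given `φ(p̄, 0)` and `∀ x (φ(p̄, ⌊x/2⌋) → φ(p̄, x))`, to reach `φ(p̄, b)` we run along the chain
`xⱼ = MSP(b, |b| ∸ j)` (`x₀ = 0`, `x_{|b|} = b`, `⌊x_{j+1}/2⌋ = xⱼ`); by the strict form
`φ(p̄, x) ↔ ∃ w ≤ r(p̄, x) π(p̄, x, w)` (`BoundedArithUnivStrict`) the step is a `∀∃` statement
over an open formula, whose Skolem symbol is iterated (`exists_iterate`), and open length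
induction (`openLIND`) on "the `j`-th iterate is a witness for `xⱼ`" finishes.

## References

* S. R. Buss, *Axiomatizations and conservation results for fragments of bounded arithmetic*,
  Contemp. Math. 106, AMS 1990, Thm. 5 (p. 8), §4.
* J. Avigad, *Saturated models of universal theories*, APAL 118 (2002), §4.
-/

namespace Literature.Computability.MetaComplexity

open FirstOrder FirstOrder.Language FirstOrder.Language.BoundedFormula
open Literature.ModelTheory.UniversalTheories

namespace QSym

open BASICModel

variable {k : ℕ} {K : Type} [Language.boundedArith.Structure K] [(Language.qsym k).Structure K]
  [(qsymι k).IsExpansionOn K] [hKB : K ⊨ BASIC]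

/-! ## The chain `xⱼ = MSP(b, |b| ∸ j)` -/

section Chain

/-- The chain term `MSP(b, |b| ∸ j)` (given terms for `b` and `j`). [folklore] -/
def chainT {α : Type} (bt jt : (Language.qsym k).Term α) : (Language.qsym k).Term α :=
  Functions.apply₂ (msp : QSym k 2) bt
    (Functions.apply₂ (monus : QSym k 2) (Functions.apply₁ (QSym.ba BoundedArithFunc.len : QSym k 1) bt) jt)

/-- The chain as a function of values. [folklore] -/
def chainV (b j : K) : K := app (msp (k := k)) ![b, app (monus (k := k)) ![mLen b, j] ]

omit hKB in
/-- Semantics of `chainT`. [folklore] -/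
@[simp] theorem realize_chainT {α : Type} (bt jt : (Language.qsym k).Term α) (v : α → K) :
    (chainT bt jt).realize v = chainV (k := k) (bt.realize v) (jt.realize v) := by
  simp only [chainT, chainV, Term.realize_functions_apply₂, Term.realize_functions_apply₁, funMap_ba]
  rfl

/-- `x₀ = 0`. [folklore] -/
theorem chainV_zero (hK : K ⊨ univTheory k) (b : K) : chainV (k := k) b 0 = 0 := by
  have h := (monus_spec hK (k := k) ![mLen b, 0]).1
  have h2 := (msp_spec hK (k := k) ![b, 0]).1
  simp only [Matrix.cons_val_zero] at h h2
  rw [chainV, h]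
  exact h2

/-- `x_{|b|} = b`. [folklore] -/
theorem chainV_mLen (hK : K ⊨ univTheory k) (b : K) : chainV (k := k) b (mLen b) = b := by
  rw [chainV]
  have h := (monus_spec hK (k := k) ![mLen b, 0]).2.1
  have h2 := (msp_spec hK (k := k) ![b, 0]).2.1
  simp only [Matrix.cons_val_zero] at h h2
  rw [h]
  exact h2

/-- `⌊x_{j+1}/2⌋ = xⱼ` for `j < |b|`. [folklore] -/
theorem mHalf_chainV_succ (hK : K ⊨ univTheory k) (b : K) {j : K} (hj : j < mLen b) :
    mHalf (chainV (k := k) b (j + 1)) = chainV (k := k) b j := by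
  rw [chainV, chainV]
  have h := (monus_spec hK (k := k) ![mLen b, j]).2.2.1
  simp only [Matrix.cons_val_zero, Matrix.cons_val_one] at h
  rw [h hj]
  have h2 := (msp_spec hK (k := k) ![b, app (monus (k := k)) ![mLen b, j + 1] ]).2.2
  simp only [Matrix.cons_val_zero, Matrix.cons_val_one] at h2
  exact h2.symm

/-- `xⱼ ≤ b`. [folklore] -/
theorem chainV_le (hK : K ⊨ univTheory k) (b j : K) : chainV (k := k) b j ≤ b := msp_le hK _ _

end Chain

/-! ## Instantiating the strict form along terms -/

section Inst

variable {m N : ℕ}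

/-- `r(p̄, x)` with the parameter variables embedded by `e` and a term for `x`. [folklore] -/
def rT (r : Language.boundedArith.Term (Empty ⊕ Fin (m + 1))) (e : Fin m → Fin N)
    (xt : (Language.qsym k).Term (Empty ⊕ Fin N)) : (Language.qsym k).Term (Empty ⊕ Fin N) :=
  (ιt r).subst (Sum.elim (fun e' => Term.var (Sum.inl e')) (Fin.snoc (fun i => qv (e i)) xt))

omit hKB in
/-- Semantics of `rT`. [folklore] -/
theorem realize_rT (r : Language.boundedArith.Term (Empty ⊕ Fin (m + 1))) (e : Fin m → Fin N)
    (xt : (Language.qsym k).Term (Empty ⊕ Fin N)) (ys : Fin N → K) :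
    (rT r e xt).realize (Sum.elim default ys) =
      r.realize (Sum.elim default (Fin.snoc (fun i => ys (e i)) (xt.realize (Sum.elim default ys)))) := by
  rw [rT, Term.realize_subst, realize_ιt]
  congr 1
  funext a
  rcases a with a | i
  · exact a.elim
  · cases i using Fin.lastCases with
    | last => simp
    | cast i => simp

/-- `π(p̄, x, w)` with the parameter variables embedded by `e` and terms for `x, w`. [folklore] -/
def πT (π : (Language.qsym k).BoundedFormula Empty (m + 2)) (e : Fin m → Fin N)
    (xt wt : (Language.qsym k).Term (Empty ⊕ Fin N)) : (Language.qsym k).BoundedFormula Empty N :=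
  substCtx π (Fin.snoc (Fin.snoc (fun i => qv (e i)) xt) wt)

omit [Language.boundedArith.Structure K] [(qsymι k).IsExpansionOn K] hKB in
/-- Semantics of `πT`. [folklore] -/
theorem realize_πT (π : (Language.qsym k).BoundedFormula Empty (m + 2)) (e : Fin m → Fin N)
    (xt wt : (Language.qsym k).Term (Empty ⊕ Fin N)) (ys : Fin N → K) :
    (πT π e xt wt).Realize default ys ↔
      π.Realize default (Fin.snoc (Fin.snoc (fun i => ys (e i)) (xt.realize (Sum.elim default ys)))
        (wt.realize (Sum.elim default ys))) := by
  rw [πT, realize_substCtx]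
  simp only [realize_snoc_terms, Term.realize, Sum.elim_inr]

omit [Language.boundedArith.Structure K] [(Language.qsym k).Structure K] [(qsymι k).IsExpansionOn K] hKB in
/-- `πT` is open if `π` is. [folklore] -/
theorem isQF_πT {π : (Language.qsym k).BoundedFormula Empty (m + 2)} (hπ : π.IsQF) (e : Fin m → Fin N)
    (xt wt : (Language.qsym k).Term (Empty ⊕ Fin N)) : (πT π e xt wt).IsQF :=
  isQF_substCtx hπ _

end Inst

/-! ## Polynomial induction for `Σᵇₖ₊₂` formulas -/

section PIND

variable {m : ℕ}

/-- **`Σᵇₖ₊₂`-PIND in a Herbrand-saturated model of `univTheory k`** (for formulas in context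
variables): if `θ(p̄, 0)` and `∀ x (θ(p̄, ⌊x/2⌋) → θ(p̄, x))` then `∀ b θ(p̄, b)`
(the model-theoretic core of Buss 1990, Thm. 5, after Avigad 2002, §4).
[cite: BussContempMath1990, Thm. 5 (p. 8)] [cite: Avigad2002, §4] -/
theorem pind_of_isSigmab_ctx (hK : K ⊨ univTheory k) (hsat : IsHerbrandSaturated (Language.qsym k) K)
    {θ : Language.boundedArith.BoundedFormula Empty (m + 1)} (hθ : IsSigmab (k + 2) θ)
    (p : Fin m → K) (h0 : θ.Realize default (Fin.snoc p 0))
    (hstep : ∀ x, θ.Realize default (Fin.snoc p (mHalf x)) → θ.Realize default (Fin.snoc p x)) (b : K) :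
    θ.Realize default (Fin.snoc p b) := by
  obtain ⟨r, π, hπ, hback, hforth⟩ := (hasStrictForm_of_isSigmab_and_of_isPib (k := k) (k + 2)).1 hθ le_rfl
  have hs : ∀ x : K, θ.Realize default (Fin.snoc p x) ↔
      ∃ w, w ≤ r.realize (Sum.elim default (Fin.snoc p x)) ∧ π.Realize default (Fin.snoc (Fin.snoc p x) w) :=
    fun x => ⟨hforth K hK hsat (Fin.snoc p x), hback K hK (Fin.snoc p x)⟩
  -- the chain and the bound
  let σ : K → K := fun j => chainV (k := k) b j
  set R : K := r.realize (Sum.elim default (Fin.snoc p b)) with hR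
  have hrR : ∀ j, r.realize (Sum.elim default (Fin.snoc p (σ j))) ≤ R := fun j =>
    realize_mono hK r fun a => by
      rcases a with a | i
      · exact le_rfl
      · cases i using Fin.lastCases with
        | last => simpa using chainV_le hK b j
        | cast i => simp
  -- the step formula `Θ(p̄, b; j, u, u')` over `(p̄, b, j, u, u')`
  let e5 : Fin m → Fin (m + 1 + 3) := fun i => (((Fin.castSucc i).castSucc).castSucc).castSucc
  let bv : (Language.qsym k).Term (Empty ⊕ Fin (m + 1 + 3)) := qv (((Fin.last m).castSucc).castSucc.castSucc)
  let jv : (Language.qsym k).Term (Empty ⊕ Fin (m + 1 + 3)) := qv ((Fin.last (m + 1)).castSucc.castSucc)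
  let uv : (Language.qsym k).Term (Empty ⊕ Fin (m + 1 + 3)) := qv (Fin.last (m + 2)).castSucc
  let u'v : (Language.qsym k).Term (Empty ⊕ Fin (m + 1 + 3)) := qv (Fin.last (m + 3))
  let jv1 : (Language.qsym k).Term (Empty ⊕ Fin (m + 1 + 3)) :=
    Functions.apply₂ (QSym.ba BoundedArithFunc.add : QSym k 2) jv qone
  let Θ : (Language.qsym k).BoundedFormula Empty (m + 1 + 3) :=
    (∼(Term.le (Functions.apply₁ (QSym.ba BoundedArithFunc.len : QSym k 1) bv) jv) ⊓
      (Term.le uv (rT r e5 (chainT bv jv)) ⊓ πT π e5 (chainT bv jv) uv)) ⟹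
    (Term.le u'v (rT r e5 (chainT bv jv1)) ⊓ πT π e5 (chainT bv jv1) u'v)
  have hΘ : Θ.IsQF :=
    ((IsAtomic.rel _ _).isQF.not.inf ((IsAtomic.rel _ _).isQF.inf (isQF_πT hπ _ _ _))).imp
      ((IsAtomic.rel _ _).isQF.inf (isQF_πT hπ _ _ _))
  have hΘsem : ∀ j u u' : K, Θ.Realize default (Fin.snoc (Fin.snoc (Fin.snoc (Fin.snoc p b) j) u) u') ↔
      ((j < mLen b ∧ u ≤ r.realize (Sum.elim default (Fin.snoc p (σ j))) ∧
          π.Realize default (Fin.snoc (Fin.snoc p (σ j)) u)) →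
        (u' ≤ r.realize (Sum.elim default (Fin.snoc p (σ (j + 1)))) ∧
          π.Realize default (Fin.snoc (Fin.snoc p (σ (j + 1))) u'))) := by
    intro j u u'
    have hj1 : jv1.realize (Sum.elim (default : Empty → K)
        (Fin.snoc (Fin.snoc (Fin.snoc (Fin.snoc p b) j) u) u')) = j + 1 := by
      simp only [jv1, jv, Term.realize_functions_apply₂, funMap_ba, Term.realize, Sum.elim_inr,
        Fin.snoc_castSucc, Fin.snoc_last, realize_qone]
      exact mAdd_eq j 1
    simp only [Θ, realize_imp, realize_inf, realize_not, realize_qle, realize_rT, realize_πT,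
      realize_chainT, hj1, Term.realize_functions_apply₁, funMap_ba, bv, jv, uv, u'v, e5,
      Term.realize, Sum.elim_inr, Fin.snoc_castSucc, Fin.snoc_last, not_le, σ]
    rfl
  -- witness of the start, totality of the step
  obtain ⟨w₀, hw₀, hπ₀⟩ := (hs (σ 0)).1 (by rw [show σ 0 = 0 from chainV_zero hK b]; exact h0)
  have htot : ∀ j u : K, ∃ u' : K, Θ.Realize default (Fin.snoc (Fin.snoc (Fin.snoc (Fin.snoc p b) j) u) u') := by
    intro j u
    by_cases hant : j < mLen b ∧ u ≤ r.realize (Sum.elim default (Fin.snoc p (σ j))) ∧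
        π.Realize default (Fin.snoc (Fin.snoc p (σ j)) u)
    · obtain ⟨hj, hu, hπu⟩ := hant
      have hQ : θ.Realize default (Fin.snoc p (σ j)) := (hs _).2 ⟨u, hu, hπu⟩
      have hQ' : θ.Realize default (Fin.snoc p (σ (j + 1))) :=
        hstep _ (by rw [show mHalf (σ (j + 1)) = σ j from mHalf_chainV_succ hK b hj]; exact hQ)
      obtain ⟨u', hu', hπu'⟩ := (hs _).1 hQ'
      exact ⟨u', (hΘsem j u u').2 fun _ => ⟨hu', hπu'⟩⟩
    · exact ⟨0, (hΘsem j u 0).2 fun h => absurd h hant⟩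
  obtain ⟨q, c, It, hIt0, hItstep⟩ := exists_iterate hK hsat hΘ (Fin.snoc p b) htot w₀ b R
  -- the invariant `Inv(c̄, w₀, p̄, b; j) := It(c̄, w₀, j) ≤ r(p̄, xⱼ) ∧ π(p̄, xⱼ, It(c̄, w₀, j))`
  let pp : Fin (q + 1 + (m + 1)) → K := Fin.append (Fin.snoc c w₀) (Fin.snoc p b)
  let cv : Fin (q + 1) → (Language.qsym k).Term (Empty ⊕ Fin (q + 1 + (m + 1) + 1)) :=
    fun i => qv (Fin.castSucc (Fin.castAdd (m + 1) i))
  let eI : Fin m → Fin (q + 1 + (m + 1) + 1) := fun i => Fin.castSucc (Fin.natAdd (q + 1) (Fin.castSucc i))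
  let bI : (Language.qsym k).Term (Empty ⊕ Fin (q + 1 + (m + 1) + 1)) :=
    qv (Fin.castSucc (Fin.natAdd (q + 1) (Fin.last m)))
  let jI : (Language.qsym k).Term (Empty ⊕ Fin (q + 1 + (m + 1) + 1)) := qv (Fin.last _)
  let ItT : (Language.qsym k).Term (Empty ⊕ Fin (q + 1 + (m + 1) + 1)) := qapp It (Fin.snoc cv jI)
  let Inv : (Language.qsym k).BoundedFormula Empty (q + 1 + (m + 1) + 1) :=
    Term.le ItT (rT r eI (chainT bI jI)) ⊓ πT π eI (chainT bI jI) ItT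
  have hInv : Inv.IsQF := (IsAtomic.rel _ _).isQF.inf (isQF_πT hπ _ _ _)
  have hIt : ∀ j : K, ItT.realize (Sum.elim (default : Empty → K) (Fin.snoc pp j)) =
      app It (Fin.snoc (Fin.snoc c w₀) j) := by
    intro j
    simp only [ItT, Term.realize, realize_snoc_terms, cv, jI, Sum.elim_inr, Fin.snoc_last,
      Fin.snoc_castSucc, pp, Fin.append_left]
  have hInvsem : ∀ j : K, Inv.Realize default (Fin.snoc pp j) ↔
      app It (Fin.snoc (Fin.snoc c w₀) j) ≤ r.realize (Sum.elim default (Fin.snoc p (σ j))) ∧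
        π.Realize default (Fin.snoc (Fin.snoc p (σ j)) (app It (Fin.snoc (Fin.snoc c w₀) j))) := by
    intro j
    have ep : (fun i => (Fin.snoc pp j : Fin (q + 1 + (m + 1) + 1) → K) (eI i)) = p := by
      funext i
      simp only [eI, Fin.snoc_castSucc, pp, Fin.append_right]
    have eb : bI.realize (Sum.elim (default : Empty → K) (Fin.snoc pp j)) = b := by
      simp only [bI, Term.realize, Sum.elim_inr, Fin.snoc_castSucc, pp, Fin.append_right, Fin.snoc_last]
    simp only [Inv, realize_inf, realize_qle, realize_rT, realize_πT, realize_chainT, hIt, ep, eb, jI,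
      Term.realize, Sum.elim_inr, Fin.snoc_last, σ]
  -- open length induction on `Inv`
  have hfin := openLIND hK hInv pp b ((hInvsem 0).2 (by rw [hIt0]; exact ⟨hw₀, hπ₀⟩)) (by
    intro j hj hIj
    rw [hInvsem] at hIj ⊢
    obtain ⟨y, hy, hyle⟩ := hItstep j hj
    rw [hΘsem] at hy
    obtain ⟨hyr, hπy⟩ := hy ⟨hj, hIj.1, hIj.2⟩
    rw [hyle (hyr.trans (hrR _))]
    exact ⟨hyr, hπy⟩)
  rw [hInvsem] at hfin
  have := (hs (σ (mLen b))).2 ⟨_, hfin.1, hfin.2⟩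
  rwa [show σ (mLen b) = b from chainV_mLen hK b] at this

/-- Formulas with free variables `Fin n` as formulas in context variables. [folklore] -/
def toCtx {n : ℕ} (φ : Language.boundedArith.Formula (Fin n)) : Language.boundedArith.BoundedFormula Empty n :=
  BoundedFormula.relabel (fun i => (Sum.inr i : Empty ⊕ Fin n)) φ

omit [(Language.qsym k).Structure K] [(qsymι k).IsExpansionOn K] hKB in
/-- Semantics of `toCtx`. [folklore] -/
theorem realize_toCtx {n : ℕ} (φ : Language.boundedArith.Formula (Fin n)) (xs : Fin n → K) :
    (toCtx φ).Realize default xs ↔ φ.Realize xs := by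
  rw [toCtx, realize_relabel]
  have e1 : (Sum.elim (default : Empty → K) (xs ∘ Fin.castAdd 0) ∘ fun i => (Sum.inr i : Empty ⊕ Fin n)) = xs := by
    funext i; simp
  have e2 : (xs ∘ Fin.natAdd n : Fin 0 → K) = default := Subsingleton.elim _ _
  rw [e1, e2]
  rfl

/-- **`Σᵇₖ₊₂`-PIND in a Herbrand-saturated model of `univTheory k`.**
[cite: BussContempMath1990, Thm. 5 (p. 8)] -/
theorem pind_of_isSigmab (hK : K ⊨ univTheory k) (hsat : IsHerbrandSaturated (Language.qsym k) K)
    (φ : Language.boundedArith.Formula (Fin (m + 1))) (hφ : IsSigmab (k + 2) φ) :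
    K ⊨ pindAxiom φ := by
  rw [realize_pindAxiom_iff]
  intro p h0 hstep b
  have hθ : IsSigmab (k + 2) (toCtx φ) := hφ.relabel _
  have h := pind_of_isSigmab_ctx hK hsat hθ p (by rw [realize_toCtx, ← mZero_eq]; exact h0)
    (fun x hx => (realize_toCtx φ _).2 (hstep x ((realize_toCtx φ _).1 hx))) b
  exact (realize_toCtx φ _).1 h

end PIND

/-! ## Herbrand-saturated models of the universal theory are models of `S₂ᵏ⁺²` -/

/-- **Every Herbrand-saturated model of `univTheory k` is a model of `S₂ᵏ⁺²`** on its reduct to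
Buss's language (the field `model_S2_succ` of `HerbrandRouteData (k + 1)`; Buss 1990, Thm. 5
model-theoretically, by the recipe of Avigad 2002, Thm. 3.4). [cite: BussContempMath1990, Thm. 5 (p. 8)] -/
theorem model_S2_of_isHerbrandSaturated (K : Type) [(Language.qsym k).Structure K]
    (hK : K ⊨ univTheory k) (hsat : IsHerbrandSaturated (Language.qsym k) K) :
    @Theory.Model Language.boundedArith K ((qsymι k).reduct K) (S2 (k + 2)) := by
  letI : Language.boundedArith.Structure K := (qsymι k).reduct K
  haveI : (qsymι k).IsExpansionOn K := LHom.isExpansionOn_reduct _ _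
  haveI : K ⊨ BASIC := model_BASIC_of_model_univTheory hK
  refine ⟨fun σ hσ => ?_⟩
  rcases hσ with hσ | hσ
  · exact Theory.realize_sentence_of_mem BASIC hσ
  · simp only [PINDScheme, Set.mem_iUnion, Set.mem_image] at hσ
    obtain ⟨m, φ, hφ, rfl⟩ := hσ
    exact pind_of_isSigmab hK hsat φ hφ

end QSym

end Literature.Computability.MetaComplexity
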